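import Mathlib
import HarnessLib
import Literature.MathematicalPhysics.QuantumFieldTheory.YangMillsOS
import Summits.QuantumFields.YangMills.Theorems.MirrorModularBoostsHypercubicLimitCouplingResponseDefsC

/-!
# Sub-schemes along a strictly increasing sequence (line `Sketch`, closure bookkeeping)

Definitions file for crux `stmt-QuantumFields-16154` (`HypercubicLimit`), line `Sketch` (coupling response).  Every closure of a
continuum-limit line passes to a subsequence `φ` (diagonal extraction of the limit functionals); the crux's clauses are then
witnessed by the SUB-SCHEME `sch.subseq φ hφ` (spacings, couplings, tori, renormalisations all composed with `φ`).  This file: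
the sub-scheme and the facts that the scheme-indexed clauses of the crux restrict to it — weak coupling, the lattice `n`-point
functions (definitionally), the uniform lattice mass gap, polynomial volume growth and renormalisation, and every
`∀ᶠ k in atTop` clause (the non-triviality / non-Gaussianity floors).  Nothing is asserted.
-/

noncomputable section

open scoped SchwartzMap
open MeasureTheory Filter Topology
open Literature.MathematicalPhysics.AQFT Literature.MathematicalPhysics.QuantumLattice
open Literature.MathematicalPhysics.QuantumFieldTheory

namespace Summit.QuantumFields.YangMills.Cruxes.HypercubicLimit.CouplingResponse

/-- **The sub-scheme along a strictly increasing `φ : ℕ → ℕ`**: all scheme data composed with `φ` (again a scheme: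
`a ∘ φ → 0`, `(a L) ∘ φ → ∞`). [folklore] -/
def subseq {ι : Type} (sch : SpeciesScheme ι) (φ : ℕ → ℕ) (hφ : StrictMono φ) : SpeciesScheme ι where
  a := fun k => sch.a (φ k)
  a_pos := fun k => sch.a_pos (φ k)
  tendsto_a := sch.tendsto_a.comp hφ.tendsto_atTop
  β := fun k => sch.β (φ k)
  L := fun k => sch.L (φ k)
  tendsto_L := sch.tendsto_L.comp hφ.tendsto_atTop
  c := fun s k => sch.c s (φ k)
  m := fun s k => sch.m s (φ k)

/-- **Eventual clauses restrict to subsequences.** [folklore] -/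
theorem eventually_subseq {φ : ℕ → ℕ} (hφ : StrictMono φ) {p : ℕ → Prop} (h : ∀ᶠ k in atTop, p k) :
    ∀ᶠ k in atTop, p (φ k) :=
  hφ.tendsto_atTop.eventually h

section Facts

variable {ι : Type} (sch : SpeciesScheme ι) (φ : ℕ → ℕ) (hφ : StrictMono φ)

/-- The sub-scheme's spacings. [folklore] -/
@[simp] theorem subseq_a (k : ℕ) : (subseq sch φ hφ).a k = sch.a (φ k) := rfl

/-- The sub-scheme's couplings. [folklore] -/
@[simp] theorem subseq_β (k : ℕ) : (subseq sch φ hφ).β k = sch.β (φ k) := rfl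

/-- The sub-scheme's torus half-sides. [folklore] -/
@[simp] theorem subseq_L (k : ℕ) : (subseq sch φ hφ).L k = sch.L (φ k) := rfl

/-- The sub-scheme's torus sides. [folklore] -/
@[simp] theorem subseq_side (k : ℕ) : (subseq sch φ hφ).side k = sch.side (φ k) := rfl

/-- The sub-scheme's multiplicative renormalisations. [folklore] -/
@[simp] theorem subseq_c (s : ι) (k : ℕ) : (subseq sch φ hφ).c s k = sch.c s (φ k) := rfl

/-- The sub-scheme's counterterms. [folklore] -/
@[simp] theorem subseq_m (s : ι) (k : ℕ) : (subseq sch φ hφ).m s k = sch.m s (φ k) := rfl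

/-- **Weak coupling restricts to sub-schemes.** [folklore] -/
theorem hasWeakCouplingLimit_subseq (h : sch.HasWeakCouplingLimit) : (subseq sch φ hφ).HasWeakCouplingLimit :=
  h.comp hφ.tendsto_atTop

/-- **Polynomial volume growth restricts to sub-schemes.** [folklore] -/
theorem polyVolume_subseq (h : PolyVolume sch) : PolyVolume (subseq sch φ hφ) := by
  obtain ⟨N, hN, hev⟩ := h
  exact ⟨N, hN, hφ.tendsto_atTop.eventually hev⟩

end Facts

section Lattice

variable {G : Type} [Group G] [TopologicalSpace G] [IsTopologicalGroup G] [CompactSpace G]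
  [MeasurableSpace G] [BorelSpace G]

/-- **The lattice `n`-point functions of the sub-scheme are those of the scheme along `φ`** (definitionally). [folklore] -/
theorem latticeSchwinger_subseq {N : ℕ} {ι : Type} (ρ : G →* Matrix (Fin N) (Fin N) ℂ) (sch : SpeciesScheme ι)
    (φ : ℕ → ℕ) (hφ : StrictMono φ) (obs : ι → LGConfig 4 G → ℝ) (k n : ℕ) (σ : Fin n → ι)
    (f : Fin n → 𝓢(EuclideanSpace ℝ (Fin 4), ℝ)) :
    latticeSchwinger ρ (subseq sch φ hφ) obs k n σ f = latticeSchwinger ρ sch obs (φ k) n σ f := rfl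

/-- **Polynomial renormalisation restricts to sub-schemes.** [folklore] -/
theorem polyRenorm_subseq (r : LatticeRep G) (sch : SpeciesScheme (YMSpecies G)) (φ : ℕ → ℕ) (hφ : StrictMono φ)
    (h : PolyRenorm r sch) : PolyRenorm r (subseq sch φ hφ) := by
  obtain ⟨Q, hQ⟩ := h
  exact ⟨Q, fun k => hQ (φ k)⟩

/-- **The uniform lattice mass gap restricts to sub-schemes** (its `k`-clause is eventual and its data are read at `φ k`).
[folklore] -/
theorem hasLatticeMassGap_subseq {ι : Type} (r : LatticeRep G) (sch : SpeciesScheme ι) (φ : ℕ → ℕ)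
    (hφ : StrictMono φ) {Δ : ℝ} (h : HasLatticeMassGap r sch Δ) : HasLatticeMassGap r (subseq sch φ hφ) Δ := by
  intro A B
  obtain ⟨C, hC⟩ := h A B
  exact ⟨C, hφ.tendsto_atTop.eventually hC⟩

end Lattice

/-- **Registered sub-goal `subseq_keeps_weak_and_gap` (line `Sketch`, closure bookkeeping)**: along a strictly increasing `φ`
the sub-scheme keeps weak coupling, the uniform lattice mass gap, and (definitionally) the lattice `n`-point functions of the
curvature. [folklore] -/
theorem subseq_keeps_weak_and_gap :
    ∀ (G : Type) [Group G] [TopologicalSpace G] [IsTopologicalGroup G] [CompactSpace G] [MeasurableSpace G] [BorelSpace G] (r : LatticeRep G) (sch : SpeciesScheme (YMSpecies G)) (φ : ℕ → ℕ) (hφ : StrictMono φ), (sch.HasWeakCouplingLimit → (subseq sch φ hφ).HasWeakCouplingLimit) ∧ (∀ Δ : ℝ, HasLatticeMassGap r sch Δ → HasLatticeMassGap r (subseq sch φ hφ) Δ) ∧ (∀ (k n : ℕ) (f : Fin n → 𝓢(EuclideanSpace ℝ (Fin 4), ℝ)), latticeSchwinger r.ρ (subseq sch φ hφ) (fun s =>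 s.F) k n (fun _ => r.curvature) f = latticeSchwinger r.ρ sch (fun s => s.F) (φ k) n (fun _ => r.curvature) f) :=
  fun _ _ _ _ _ _ _ r sch φ hφ =>
    ⟨hasWeakCouplingLimit_subseq sch φ hφ, fun _ h => hasLatticeMassGap_subseq r sch φ hφ h, fun _ _ _ => rfl⟩

end Summit.QuantumFields.YangMills.Cruxes.HypercubicLimit.CouplingResponse

end
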